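import Mathlib.MeasureTheory.Group.Measure
import Literature.Analysis.FunctionSpaces.TorusPeriodizationCube
import HarnessLib

/-!
# Grid cells of mesh `N⁻¹` in `ℝ^d` and cell integrals of periodisations

Analysis/FunctionSpaces support file (notion `flat_torus_T3`), companion of `TorusCellAverages`:
the half-open grid cells `m/N + N⁻¹[0,1)^d = {y | N • y - m ∈ [0,1)^d}`, `m ∈ ℤ^d` (the squares
`Q ∈ 𝒬(N)` of Bruè–De Lellis 2023, §4, up to null sets, when `m ∈ {0,…,N-1}^d`), written with
the accepted `Torus.unitCube` / `Torus.latticeVec`: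

* `mem_gridCell_iff` (coordinatewise description), `measurableSet_gridCell`;
* `gridCell_eq_preimage_sub`, `gridCell_mod_subset_unitCube` — the cell of index `m` is the
  lattice translate by `m / N` (coordinatewise integer division) of the cell of index `m % N`,
  which lies in the fundamental cube `[0,1)^d`;
* `setIntegral_gridCell_perSum_eq_zero` — if `g` vanishes off the open unit cube and has zero
  integral on every cell, then so has its periodisation `perSum g` on every cell of `ℝ^d`
  (translation invariance of Lebesgue measure): the form in which the cell clause of
  `Literature.Analysis.FluidPDE.alberti_crippa_mazzucato_planar_family` feeds the hypothesis of
  `Torus.eHomSobolevSeminorm_neg_one_le_of_cellAverage_eq_zero`.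

## References

* E. Bruè, C. De Lellis, Comm. Math. Phys. 400 (2023), §4 (notation `𝒬(λ)`), Thm. 4.1 (4.3).
-/

noncomputable section

open Set Function Filter Metric MeasureTheory
open scoped NNReal ENNReal

namespace Literature.Analysis.FunctionSpaces

namespace Torus

variable {d : Type*} [Fintype d] [DecidableEq d]
variable {F : Type*} [NormedAddCommGroup F] [NormedSpace ℝ F]

/-! ## Grid cells -/

/-- Membership in the grid cell `m/N + N⁻¹[0,1)^d`, coordinatewise. [folklore] -/
theorem mem_gridCell_iff {N : ℕ} (hN : 0 < N) {m : d → ℤ} {y : EuclideanSpace ℝ d} :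
    (N : ℝ) • y - latticeVec m ∈ unitCube d ↔
      ∀ i, (m i : ℝ) / N ≤ y i ∧ y i < ((m i : ℝ) + 1) / N := by
  have hN' : (0 : ℝ) < N := by exact_mod_cast hN
  simp only [mem_unitCube, PiLp.sub_apply, PiLp.smul_apply, smul_eq_mul, latticeVec_apply, mem_Ico]
  refine forall_congr' fun i => ?_
  rw [div_le_iff₀ hN', lt_div_iff₀ hN']
  constructor <;> rintro ⟨h1, h2⟩ <;> constructor <;> nlinarith

/-- The grid cells are measurable. [folklore] -/
theorem measurableSet_gridCell (N : ℕ) (m : d → ℤ) :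
    MeasurableSet {y : EuclideanSpace ℝ d | (N : ℝ) • y - latticeVec m ∈ unitCube d} :=
  measurableSet_unitCube.preimage (by fun_prop)

/-- **Reduction of a cell index modulo `N`.** The cell with index `m` is the translate by the
lattice vector `m / N` (coordinatewise integer division) of the cell with index `m % N`, which
lies in the fundamental cube. [folklore] -/
theorem gridCell_eq_preimage_sub (N : ℕ) (m : d → ℤ) :
    {y : EuclideanSpace ℝ d | (N : ℝ) • y - latticeVec m ∈ unitCube d} =
      (fun y => y - latticeVec (fun i => m i / N)) ⁻¹'
        {y | (N : ℝ) • y - latticeVec (fun i => m i % N) ∈ unitCube d} := by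
  ext y
  simp only [mem_setOf_eq, mem_preimage, mem_unitCube, PiLp.sub_apply, PiLp.smul_apply,
    smul_eq_mul, latticeVec_apply, mem_Ico]
  refine forall_congr' fun i => ?_
  have hdiv : ((m i % N : ℤ) : ℝ) = m i - N * ((m i / N : ℤ) : ℝ) := by
    have := Int.emod_add_mul_ediv (m i) N
    have h' : ((m i % N : ℤ) : ℝ) + (N : ℝ) * ((m i / N : ℤ) : ℝ) = m i := by exact_mod_cast this
    linarith
  rw [hdiv]
  constructor <;> rintro ⟨h1, h2⟩ <;> constructor <;> nlinarith

/-- The cell with a reduced index `m % N` lies in the fundamental cube `[0,1)^d`. [folklore] -/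
theorem gridCell_mod_subset_unitCube {N : ℕ} (hN : 0 < N) (m : d → ℤ) :
    {y : EuclideanSpace ℝ d | (N : ℝ) • y - latticeVec (fun i => m i % N) ∈ unitCube d} ⊆
      unitCube d := by
  intro y hy i
  have hN' : (0 : ℝ) < N := by exact_mod_cast hN
  have h := (mem_gridCell_iff hN).1 hy i
  have h0 : (0 : ℝ) ≤ ((m i % N : ℤ) : ℝ) := by exact_mod_cast Int.emod_nonneg _ (by exact_mod_cast hN.ne')
  have h1 : ((m i % N : ℤ) : ℝ) + 1 ≤ N := by
    have : (m i % N : ℤ) + 1 ≤ N := Int.add_one_le_iff.2 (Int.emod_lt_of_pos _ (by exact_mod_cast hN))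
    exact_mod_cast this
  constructor
  · exact le_trans (div_nonneg h0 hN'.le) h.1
  · exact lt_of_lt_of_le h.2 ((div_le_one hN').2 h1)

/-- **Cell integrals of a cube-supported periodisation.** If `g` vanishes off the open unit cube
and has zero integral over every grid cell of mesh `N⁻¹` inside the fundamental cube — indeed
over every cell — then so does its periodisation `perSum g`, over every cell `m ∈ ℤ^d`
(translate the cell into the fundamental cube, where `perSum g = g`). [folklore] -/
theorem setIntegral_gridCell_perSum_eq_zero {g : EuclideanSpace ℝ d → F}
    (hg : ∀ y, (¬ ∀ i, y i ∈ Ioo (0 : ℝ) 1) → g y = 0) {N : ℕ} (hN : 0 < N)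
    (h0 : ∀ m : d → ℤ, ∫ y in {y : EuclideanSpace ℝ d | (N : ℝ) • y - latticeVec m ∈ unitCube d}, g y = 0)
    (m : d → ℤ) :
    ∫ y in {y : EuclideanSpace ℝ d | (N : ℝ) • y - latticeVec m ∈ unitCube d}, perSum g y = 0 := by
  set q : d → ℤ := fun i => m i / N with hq
  set C : Set (EuclideanSpace ℝ d) :=
    {y | (N : ℝ) • y - latticeVec (fun i => m i % N) ∈ unitCube d} with hC
  have hpre := gridCell_eq_preimage_sub N m
  have hmp : MeasurePreserving (fun y : EuclideanSpace ℝ d => y - latticeVec q) volume volume :=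
    measurePreserving_sub_right volume _
  have hme : MeasurableEmbedding fun y : EuclideanSpace ℝ d => y - latticeVec q :=
    (MeasurableEquiv.subRight (latticeVec q)).measurableEmbedding
  -- on the cell, `perSum g y = g (y - q)`
  have heq : ∀ y ∈ {y : EuclideanSpace ℝ d | (N : ℝ) • y - latticeVec m ∈ unitCube d},
      perSum g y = g (y - latticeVec q) := by
    intro y hy
    rw [hpre] at hy
    have hy' : y - latticeVec q ∈ unitCube d := gridCell_mod_subset_unitCube hN m hy
    rw [← perSum_eq_self_of_mem_unitCube hg hy']
    conv_lhs => rw [show y = y - latticeVec q + latticeVec q by abel]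
    exact perSum_add_latticeVec g _ q
  rw [setIntegral_congr_fun (measurableSet_gridCell N m) heq, hpre,
    hmp.setIntegral_preimage_emb hme g C]
  exact h0 _


end Torus

end Literature.Analysis.FunctionSpaces

end
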